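import Summits.BirchSwinnertonDyer.BirchSwinnertonDyer.Theorems.KolyvaginDepthDoorKNSupplyModPRigidity
import Summits.BirchSwinnertonDyer.BirchSwinnertonDyer.Theorems.ErratumRoadFiveNonSurjCornerTamagawaExponent
import HarnessLib

/-!
# Route `KolyvaginDepthDoor`, crux `KolyvaginDepthSupplyKN` (stmt-BirchSwinnertonDyer-22820) —
# THE RESIDUAL STRUCTURE STUB OF LINE `levelone` DISCHARGED MODULO PRINT + A `p`-OPTIMAL FRAME

Helper file of the lead prover of line `levelone` (kdd-p1 g13; `--supports stmt-BirchSwinnertonDyer-22820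
--as helper`); it closes nothing and BSD is not proved by it.

Skeleton v6 (g12) consumed, on the ♠ (2)-residual class at analytic rank `≥ 2`, the stub
`stub_modPStructureResidualRankTwo` — per `(E, p, K)` produced by the line, a level-one class
`c_1(n) ≠ 0`, `n ∈ Λ`, with `#Sel_p(E/ℚ) = p^{ν(n)+1} ∨ #Sel_p(E^{(d_K)}/ℚ) = p^{ν(n)+1}` — "open as
typed, print untyped". With the named fact
`Literature.NumberTheory.EllipticCurves.HowardZanarella_exists_minimal_kolyvaginClass_one_selmerCard_of_ne_zero`
(Howard 2004 / Zanarella 2019 mod-`p` rigidity, filed by this seat, p675362) the print is now typed, and: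

* `modPStructureResidualRankTwo_of_print` — THE STUB'S SIGNATURE VERBATIM, proved from
  (i) `BurungaleEtAl2026.thm2_…` (BCGS 2026 Thm. 2), (ii) `Zanarella2019_kolyvaginClass_one_ne_zero_of_not_divisible`
  (Zanarella Prop. 2.18), (iii) the Howard–Zanarella rigidity fact, (iv) modularity
  `exists_isNewformOf` (already the first conjunct of the line's `stub_twistSupplyPrintFacts`), and
  (v) THE ONE REMAINING BOOKKEEPING INPUT `hOpt`: a `p`-OPTIMAL parametrisation datum of `E` at level
  `N_E` exists when `ρ̄_{E,p}` is onto (Burungale–Castella–Grossi–Skinner, §1.2: *"If (irr) holds,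
  then `π` is `p`-optimal and `π` (and `E`) is uniquely determined up to a prime-to-`p` isogeny"*;
  in the tree this wants the divisibility of every modular degree in the class by the optimal one —
  the universal property of the optimal quotient — which the tree records only as an inequality,
  `Literature.NumberTheory.Automorphic.exists_optimal_modularParametrizationData_of_isNewformOf'`).
  Of the stub's hypotheses only `p ≥ 5` good ordinary, `ρ̄`/tower onto, the Kodaira–Néron conjunct
  (whence `p ∤ Tam_E`, `CornerLocal.not_dvd_tamagawaProduct_iff_forall`), `K` Heegner with `d_K` odd,
  `≠ −3, −4`, `p ∤ d_K`, `p` split, `(d_K, N) = 1` are used; non-CM, analytic rank `≥ 2`, the residual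
  predicate, `Ш(E)[p] = 0`, `Ш(E^{(d_K)})[p] = 0`, `rank E^{(d_K)} ≤ 1` are idle (the structure
  statement is print on the whole Kodaira–Néron cell).
(The v7 COMPOSITION — v6's `kolyvaginDepthSupplyKN_of_hypotheses_residualStructureSplit` with this
discharge plugged in — is the sibling file `KolyvaginDepthDoorKNSupplyCompositionV7`.)

CONDITIONAL (named facts as hypotheses; `hOpt` open as typed); BSD is NOT proved by any of this.

References: [BurungaleEtAl2026] Thm. 2 and §1.2 (arXiv:2312.09301, held text p0010 L29–L32);
[Zanarella2019] Prop. 2.18, Cor. 2.12, 2.14, Prop. 2.15; [Howard2004] Thm. 1.4.2, Prop. 1.5.5,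
Lemma 1.6.4; [WZhang2014] Lemma 8.4 (1), Thm. 9.1; [SilvermanATAEC1994] Cor. IV.9.2 (d), Table 4.1
(`c_v` on the Kodaira–Néron cell); [Tate1974] Conj. 1.
-/

-- D-0017: single-problem summit, `Summit.BirchSwinnertonDyer.BirchSwinnertonDyer.…` repeats a namespace BY DESIGN.
set_option linter.dupNamespace false

noncomputable section

open scoped Classical NumberField

namespace Summit.BirchSwinnertonDyer.BirchSwinnertonDyer.Theorems.KolyvaginDepthDoor

open Literature.NumberTheory.EllipticCurves Literature.NumberTheory.EllipticCurves.ModularForms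
  WeierstrassCurve IsDedekindDomain
open Summit.BirchSwinnertonDyer.BirchSwinnertonDyer.Theorems

/-- **`p ∤ Tam_E` on the Kodaira–Néron cell** (`p ≥ 5`; `p ∤ ord_v(Δ_min)` at every multiplicative
place `v`): for `p ≥ 5`, `p ∣ ∏_v c_v` iff `p ∣ ord_v(Δ_min) = c_v` at some SPLIT multiplicative place
(`CornerLocal.not_dvd_tamagawaProduct_iff_forall`; `c_v ≤ 4` elsewhere). UNCONDITIONAL.
[cite: SilvermanATAEC1994, Cor. IV.9.2 (d) and Table 4.1] -/
theorem not_dvd_tamagawaProduct_of_kodairaNeron (W : WeierstrassCurve ℚ) [W.IsElliptic]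
    (p : ℕ) [Fact p.Prime] (h5 : 5 ≤ p)
    (hKN : ∀ v : HeightOneSpectrum (𝓞 ℚ), W.HasMultiplicativeReductionAt v →
      ¬ p ∣ W.ordMinimalDiscriminant v) :
    ¬ p ∣ W.tamagawaProduct :=
  (CornerLocal.not_dvd_tamagawaProduct_iff_forall W p h5).mpr
    fun v hs ↦ hKN v hs.hasMultiplicativeReductionAt

/-- **The residual structure stub of line `levelone` (skeleton v5/v6, `stub_modPStructureResidualRankTwo`),
SIGNATURE VERBATIM, modulo print + a `p`-optimal frame.** Inputs: BCGS 2026 Thm. 2 (`h2`),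
Zanarella 2019 Prop. 2.18 (`hZ`), Howard–Zanarella mod-`p` rigidity (`hHZ`), modularity (`hmod`),
and `hOpt` (a `p`-optimal parametrisation datum at level `N_E` for `ρ̄_{E,p}` onto — bookkeeping,
open as typed). Then for every `(E, p, K)` of the stub: a frame, `n ∈ Λ` and a datum with
`c_1(n) ≠ 0` and `#Sel_p(E/ℚ) = p^{ν(n)+1} ∨ #Sel_p(E^{(d_K)}/ℚ) = p^{ν(n)+1}`. Proof:
`exists_kolyvaginClass_one_selmerCard_of_print` with `p ∤ Tam_E` from the Kodaira–Néron conjunct.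
The non-CM / analytic-rank / residual / `Ш` / twist-rank hypotheses are idle. CONDITIONAL.
[cite: BurungaleEtAl2026, Thm. 2 and §1.2] [cite: Zanarella2019, Prop. 2.18, Cor. 2.14]
[cite: Howard2004, Lemma 1.6.4] [cite: WZhang2014, Lemma 8.4 (1) (p. 236)] -/
theorem modPStructureResidualRankTwo_of_print
    (h2 : BurungaleEtAl2026.thm2_kolyvaginClass_divisibility_eq_padicValNat_tamagawaProduct)
    (hZ : Literature.NumberTheory.EllipticCurves.Zanarella2019_kolyvaginClass_one_ne_zero_of_not_divisible)
    (hHZ : Literature.NumberTheory.EllipticCurves.HowardZanarella_exists_minimal_kolyvaginClass_one_selmerCard_of_ne_zero)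
    (hmod : exists_isNewformOf)
    (hOpt : exists_isNewformOf →
      ∀ (W : WeierstrassCurve ℚ) [W.IsElliptic] [W.IsGloballyMinimal] (p : ℕ) [Fact p.Prime],
        5 ≤ p → W.HasSurjectiveModNGaloisRep p → ∀ [NeZero (W.conductorNorm ℤ)],
          ∃ Dt : ModularParametrizationData W (W.conductorNorm ℤ), Dt.IsPOptimal p) :
    ∀ (W : WeierstrassCurve ℚ) [W.IsElliptic] [W.IsGloballyMinimal], ¬ W.HasCM → 2 ≤ W.analyticRank →
      ¬ (Squarefree (W.conductorNorm ℤ) ∨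
          ∃ (ℓ₁ ℓ₂ : ℕ) (_ : Fact ℓ₁.Prime) (_ : Fact ℓ₂.Prime), ℓ₁ ≠ ℓ₂ ∧
            W.HasMultiplicativeReductionAtPrime ℓ₁ ∧ W.HasMultiplicativeReductionAtPrime ℓ₂) →
      ∀ (p : ℕ) [hp : Fact p.Prime], 5 ≤ p → W.HasGoodReductionAtPrime p →
        ¬ (p : ℤ) ∣ W.frobeniusTrace p → W.HasSurjectiveModNGaloisRep p →
        (∀ n : ℕ, W.HasSurjectiveModNGaloisRep (p ^ n : ℕ)) →
        (∀ (ℓ : ℕ) [Fact ℓ.Prime], W.HasMultiplicativeReductionAtPrime ℓ →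
          ¬ p ∣ padicValInt ℓ W.minimalDiscriminantInt) →
        (∀ v : HeightOneSpectrum (𝓞 ℚ), W.HasMultiplicativeReductionAt v →
          ¬ p ∣ W.ordMinimalDiscriminant v) →
        ∀ (K : Type) [Field K] [NumberField K], IsImaginaryQuadratic K →
          Odd (NumberField.discr K) → NumberField.discr K ≠ -3 → NumberField.discr K ≠ -4 →
          ¬ ((p : ℤ) ∣ NumberField.discr K) → SatisfiesHeegnerHypothesis p K →
          IsCoprime (NumberField.discr K) ((W.conductorNorm ℤ : ℕ) : ℤ) →
          ∀ [NeZero (W.conductorNorm ℤ)], SatisfiesHeegnerHypothesis (W.conductorNorm ℤ) K →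
          (W.sha ⊓ AddSubgroup.torsionBy W.galH1 (p : ℤ) : AddSubgroup W.galH1) = ⊥ →
          ((W.quadraticTwist (NumberField.discr K : ℚ)).sha ⊓
              AddSubgroup.torsionBy (W.quadraticTwist (NumberField.discr K : ℚ)).galH1 (p : ℤ) :
              AddSubgroup (W.quadraticTwist (NumberField.discr K : ℚ)).galH1) = ⊥ →
          (W.quadraticTwist (NumberField.discr K : ℚ)).mordellWeilRank ≤ 1 →
          ∃ (Dt : ModularParametrizationData W (W.conductorNorm ℤ)) (β : ℤ) (ι : K →+* ℂ) (n : ℕ)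
            (d : KolyvaginHeegnerData Dt β ι n),
            KolyvaginDescent.KolSupp (Zhang2014.IsKolyvaginPrime (W.conductorNorm ℤ) W K p) n ∧
              d.kolyvaginClass hp.out 1 ≠ 0 ∧
              (Nat.card (W.selmerGroup p) = p ^ (n.primeFactors.card + 1) ∨
                Nat.card ((W.quadraticTwist (NumberField.discr K : ℚ)).selmerGroup p) =
                  p ^ (n.primeFactors.card + 1)) := by
  intro W _ _ _hcm _h2 _hres p hp h5 hgood hord hsurj htower _hS1 hKN K _ _ hK hodd hD3 hD4 hpD hspl
    hDN _ hH _hshaW _hshaT _hT1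
  have htam : ¬ p ∣ W.tamagawaProduct := not_dvd_tamagawaProduct_of_kodairaNeron W p h5 hKN
  exact exists_kolyvaginClass_one_selmerCard_of_print h2 hZ hHZ W p h5 hgood hord hsurj htower htam
    K hK hH hodd hD3 hD4 hDN hpD hspl (hOpt hmod W p h5 hsurj)

end Summit.BirchSwinnertonDyer.BirchSwinnertonDyer.Theorems.KolyvaginDepthDoor

end
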